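import Summits.Ventures.DiscreteObjects.Hadamard.Order334Orbits
import Summits.Ventures.DiscreteObjects.Hadamard.FixedRowsOrbitTools

/-!
# Hadamard 668 census, family F12 — the involution census: fixed rows and columns of a signed involution of H(668) (kernel)

Framing: lottery ticket; floor = certified bounds/negative ranges.

Cell pub-namedobj (venture DiscreteObjects), target (H), hadamard gen 12.  ORDER 2.  Let `(π, κ, d, e)` be a signed-permutation
automorphism of a Hadamard matrix of order `668` with `π² = κ² = 1`, `(π, κ) ≠ (1, 1)`, and let `f_r = #Fix π`, `f_c = #Fix κ`.
**`hadamard668_involution_census`**: `π ≠ 1` and `κ ≠ 1` (`signedAut_snd_eq_one_of_fst_eq_one`), and exactly one of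
* TYPE I  (`involution668_typeI`): `f_r = f_c = f` with `f` even, `2 ≤ f ≤ 332`, and ALL fixed rows and columns carry one common
  sign `δ` (trace lemma `Σ_{Fix π} d = Σ_{Fix κ} e`; `f ≤ 334` from the row-pair identity `δ f = −Σ_{moved}(±1)`; `f ≠ 334` is
  `order334_case334`);
* TYPE II (`involution668_typeII`): `f_r = 0`, `f_c = 4` with signs `+,+,−,−` (trace lemma gives sign sum `0`; the row-pair identity
  mod 4 gives `4 ∣ f_c`; three fixed columns of one sign would be three pairwise-orthogonal `±1` columns whose agreement set is a
  union of free `π`-pairs, forcing `8 ∣ 668`); or its transpose `f_r = 4`, `f_c = 0`;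
* TYPE III: `f_r = f_c = 0`.
(The classical weighing-matrix refinement `f ≡ 0 (mod 4)` in type I — `W((668 − f)/2, 167)` of odd order is impossible — is left
to a companion file.)  This is the input an 'order 2p' analysis needs (centraliser lemma: `f_h = p·a + f''`); by itself it excludes
no even order, cf. FAMILY-F12-G12.  Ours, not literature (nearest print: Kimura's type analysis of involutions for orders 24–32);
no `sorry`.
-/

namespace Summit.Ventures.DiscreteObjects.Hadamard

open Finset BigOperators Matrix

open Literature.Combinatorics.Designs.GoethalsSeidel (IsHadamardMatrix)

variable {ι : Type*} [Fintype ι] [DecidableEq ι]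

variable {H : Matrix ι ι ℤ} {π κ : Equiv.Perm ι} {d e : ι → ℤ}

/-- **Type II.**  No fixed row but a fixed column: then exactly four columns are fixed, two of each sign. -/
theorem involution668_typeII (hH : IsHadamardMatrix H) (hι : Fintype.card ι = 668) (haut : IsSignedAut H π κ d e)
    (hπinv : ∀ i, π (π i) = i) (hκinv : ∀ j, κ (κ j) = j) (hfr : ∀ i, π i ≠ i) (hfc : ∃ j, κ j = j) :
    (univ.filter fun j => κ j = j).card = 4 ∧ ∑ j ∈ univ.filter (fun j => κ j = j), e j = 0 := by
  have hcard : (Fintype.card ι : ℤ) ≠ 0 := by rw [hι]; norm_num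
  have hd := haut.1
  have he := haut.2.1
  have hA := haut.2.2
  obtain ⟨c₀, hc₀⟩ := hfc
  -- sign sum of the fixed columns vanishes (trace lemma, no fixed rows)
  have hS : ∑ j ∈ univ.filter (fun j => κ j = j), e j = 0 := by
    rw [← signedAut_trace hH hcard haut]
    have : (univ.filter fun i => π i = i) = ∅ := by
      rw [Finset.filter_eq_empty_iff]; intro i _; exact hfr i
    rw [this, Finset.sum_empty]
  refine ⟨?_, hS⟩
  -- type ε = +1
  have hdinv : ∀ i, d (π i) = d i := by
    intro i
    have h := signedAut_sq_sign hH.1 haut hπinv hκinv i c₀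
    rw [hc₀, pm_mul_self (he c₀), mul_one] at h
    exact (pm_eq_of_mul_eq_one (hd i) (hd (π i)) h).symm
  have heinv : ∀ j, e (κ j) = e j := by
    intro j
    have h := signedAut_sq_sign hH.1 haut hπinv hκinv c₀ j
    rw [hdinv c₀, pm_mul_self (hd c₀), one_mul] at h
    exact (pm_eq_of_mul_eq_one (he j) (he (κ j)) h).symm
  -- 4 ∣ f_c : row-pair identity at any row, mod 4
  obtain ⟨i₀⟩ : Nonempty ι := ⟨c₀⟩
  have hrow := signedAut_rowPair hH haut (hfr i₀)
  rw [← Finset.sum_filter_add_sum_filter_not univ (fun j => κ j = j)] at hrow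
  have hfix : ∑ j ∈ univ.filter (fun j => κ j = j), e j * (H i₀ j * H i₀ (κ j)) = 0 := by
    rw [← hS]
    refine Finset.sum_congr rfl fun j hj => ?_
    have hj' : κ j = j := by simpa using hj
    rw [hj', pm_mul_self (hH.1 i₀ j), mul_one]
  rw [hfix, zero_add] at hrow
  obtain ⟨m, hm⟩ := sum_moved_eq_card_sub_four_mul κ hκinv (fun j => e j * (H i₀ j * H i₀ (κ j)))
    (fun j _ => by
      rcases he j with h | h <;> rcases hH.1 i₀ j with h1 | h1 <;> rcases hH.1 i₀ (κ j) with h2 | h2 <;> simp [h, h1, h2])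
    (fun j _ => by
      show e (κ j) * (H i₀ (κ j) * H i₀ (κ (κ j))) = e j * (H i₀ j * H i₀ (κ j))
      rw [heinv j, hκinv j]; ring)
  have eC : (univ.filter fun j => κ j ≠ j) = univ.filter (fun j => ¬ κ j = j) := rfl
  rw [eC, hrow] at hm
  have hsplit := Finset.card_filter_add_card_filter_not (s := (univ : Finset ι)) (fun j => κ j = j)
  rw [Finset.card_univ, hι] at hsplit
  -- at most two fixed columns of each sign
  have htwo : ∀ s : ℤ, (s = 1 ∨ s = -1) → (univ.filter fun j => κ j = j ∧ e j = s).card ≤ 2 := by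
    intro s hs
    by_contra h3
    obtain ⟨j₁, j₂, j₃, hj₁, hj₂, hj₃, h12, h13, h23⟩ := Finset.two_lt_card_iff.mp (not_le.mp h3)
    simp only [Finset.mem_filter, Finset.mem_univ, true_and] at hj₁ hj₂ hj₃
    have key := card_eq_four_mul_of_three_orth (univ : Finset ι) (fun i => H i j₁) (fun i => H i j₂) (fun i => H i j₃)
      (fun i _ => hH.1 i j₁) (fun i _ => hH.1 i j₂) (fun i _ => hH.1 i j₃)
      (hadamard_col_orth H hH hcard h12) (hadamard_col_orth H hH hcard h13) (hadamard_col_orth H hH hcard h23)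
    rw [Finset.card_univ, hι] at key
    have hcol : ∀ {j}, κ j = j → e j = s → ∀ i, H (π i) j = d i * s * H i j := by
      intro j hj hs' i
      have h := hA i j
      rw [hj, hs'] at h
      exact h
    have hπ2 : π ^ 2 = 1 := by ext x; simp [pow_two, hπinv x]
    have hAdvd : 2 ∣ (univ.filter fun i => H i j₁ = H i j₂ ∧ H i j₁ = H i j₃).card := by
      apply dvd_card_of_free π (by norm_num) hπ2 _ _ le_rfl
      · intro y hy
        simp only [Finset.mem_filter, Finset.mem_univ, true_and] at hy ⊢
        rw [hcol hj₁.1 hj₁.2, hcol hj₂.1 hj₂.2, hcol hj₃.1 hj₃.2]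
        exact ⟨by rw [hy.1], by rw [hy.2]⟩
      · intro y _ k hk0 hk2
        have : k = 1 := by omega
        subst this
        simpa using hfr y
    obtain ⟨a, ha⟩ := hAdvd
    rw [ha] at key
    push_cast at key
    omega
  have hle : (univ.filter fun j => κ j = j).card ≤ 4 := by
    rw [card_filter_split (fun j => κ j = j) (fun j => e j = 1)]
    have h1 := htwo 1 (Or.inl rfl)
    have h2 := htwo (-1) (Or.inr rfl)
    have e2 : (univ.filter fun j => κ j = j ∧ ¬ e j = 1) = univ.filter (fun j => κ j = j ∧ e j = -1) := by
      ext j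
      simp only [Finset.mem_filter, Finset.mem_univ, true_and]
      constructor
      · rintro ⟨h, h'⟩
        rcases he j with h'' | h''
        · exact absurd h'' h'
        · exact ⟨h, h''⟩
      · rintro ⟨h, h'⟩
        exact ⟨h, by rw [h']; norm_num⟩
    rw [e2]
    omega
  have hpos : 0 < (univ.filter fun j => κ j = j).card :=
    Finset.card_pos.mpr ⟨c₀, by simp [hc₀]⟩
  omega

/-- **Type I.**  A fixed row and a fixed column: then all fixed rows and columns carry one common sign `δ`, their numbers agree,
`f_r = f_c = f` is even and `f ≤ 332` (given `π ≠ 1`). -/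
theorem involution668_typeI (hH : IsHadamardMatrix H) (hι : Fintype.card ι = 668) (haut : IsSignedAut H π κ d e)
    (hπinv : ∀ i, π (π i) = i) (hκinv : ∀ j, κ (κ j) = j) (hr : ∃ i, π i = i) (hc : ∃ j, κ j = j) (hne : π ≠ 1) :
    (univ.filter fun i => π i = i).card = (univ.filter fun j => κ j = j).card ∧
    (∃ δ : ℤ, (δ = 1 ∨ δ = -1) ∧ (∀ i, π i = i → d i = δ) ∧ (∀ j, κ j = j → e j = δ)) ∧
    2 ∣ (univ.filter fun i => π i = i).card ∧ (univ.filter fun i => π i = i).card ≤ 332 := by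
  have hcard : (Fintype.card ι : ℤ) ≠ 0 := by rw [hι]; norm_num
  have hd := haut.1
  have he := haut.2.1
  obtain ⟨r₀, hr₀⟩ := hr
  obtain ⟨c₀, hc₀⟩ := hc
  -- common sign
  have heδ : ∀ j, κ j = j → e j = d r₀ := fun j hj => (signedAut_fixed_sign hH.1 haut hr₀ hj).symm
  have hdδ : ∀ i, π i = i → d i = d r₀ := by
    intro i hi; rw [signedAut_fixed_sign hH.1 haut hi hc₀, heδ c₀ hc₀]
  have hδ : d r₀ = 1 ∨ d r₀ = -1 := hd r₀
  -- trace lemma ⇒ f_r = f_c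
  have htr := signedAut_trace hH hcard haut
  rw [Finset.sum_congr rfl fun i hi => hdδ i (by simpa using hi), Finset.sum_congr rfl fun j hj => heδ j (by simpa using hj),
    Finset.sum_const, Finset.sum_const, nsmul_eq_mul, nsmul_eq_mul] at htr
  have hδ0 : d r₀ ≠ 0 := pm_ne_zero hδ
  have hfeq : ((univ.filter fun i => π i = i).card : ℤ) = ((univ.filter fun j => κ j = j).card : ℤ) :=
    mul_right_cancel₀ hδ0 htr
  have hfeq' : (univ.filter fun i => π i = i).card = (univ.filter fun j => κ j = j).card := by exact_mod_cast hfeq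
  -- f even
  have hsplitR := Finset.card_filter_add_card_filter_not (s := (univ : Finset ι)) (fun i => π i = i)
  rw [Finset.card_univ, hι] at hsplitR
  have h2R := two_dvd_card_moved π hπinv
  have eR : (univ.filter fun i => π i ≠ i) = univ.filter (fun i => ¬ π i = i) := rfl
  rw [eR] at h2R
  obtain ⟨b, hb⟩ := h2R
  refine ⟨hfeq', ⟨d r₀, hδ, hdδ, heδ⟩, ⟨334 - b, by omega⟩, ?_⟩
  · -- f ≤ 334 by the row-pair identity, and f ≠ 334 by `order334_case334`
    obtain ⟨i₀, hi₀⟩ : ∃ i, π i ≠ i := by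
      by_contra h
      exact hne (Equiv.ext fun i => not_not.mp (not_exists.mp h i))
    have hrow := signedAut_rowPair hH haut hi₀
    rw [← Finset.sum_filter_add_sum_filter_not univ (fun j => κ j = j)] at hrow
    have hfix : ∑ j ∈ univ.filter (fun j => κ j = j), e j * (H i₀ j * H i₀ (κ j))
        = d r₀ * ((univ.filter fun j => κ j = j).card : ℤ) := by
      have e1 : ∑ j ∈ univ.filter (fun j => κ j = j), e j * (H i₀ j * H i₀ (κ j))
          = ∑ j ∈ univ.filter (fun j => κ j = j), d r₀ := by
        refine Finset.sum_congr rfl fun j hj => ?_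
        have hj' : κ j = j := by simpa using hj
        rw [hj', pm_mul_self (hH.1 i₀ j), mul_one, heδ j hj']
      rw [e1, Finset.sum_const, nsmul_eq_mul, mul_comm]
    rw [hfix] at hrow
    have hbound := abs_sum_pm_le_card (univ.filter fun j => ¬ κ j = j) (fun j => e j * (H i₀ j * H i₀ (κ j)))
      (fun j _ => by
        rcases he j with h | h <;> rcases hH.1 i₀ j with h1 | h1 <;> rcases hH.1 i₀ (κ j) with h2 | h2 <;> simp [h, h1, h2])
    have hsplit := Finset.card_filter_add_card_filter_not (s := (univ : Finset ι)) (fun j => κ j = j)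
    rw [Finset.card_univ, hι] at hsplit
    have hM : ∑ j ∈ univ.filter (fun j => ¬ κ j = j), e j * (H i₀ j * H i₀ (κ j))
        = -(d r₀ * ((univ.filter fun j => κ j = j).card : ℤ)) := by linarith
    rw [hM, abs_neg, abs_mul] at hbound
    have habs : |d r₀| = 1 := by rcases hδ with h | h <;> simp [h]
    rw [habs, one_mul, Nat.abs_cast] at hbound
    have hle : (univ.filter fun j => κ j = j).card ≤ 334 := by
      have h1 : ((univ.filter fun j => κ j = j).card : ℤ) ≤ ((univ.filter fun j => ¬ κ j = j).card : ℤ) := hbound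
      omega
    have hne334 : (univ.filter fun i => π i = i).card ≠ 334 := by
      intro h334
      exact order334_case334 hH hι haut hπinv hκinv h334 (Or.inr (by rw [← hfeq', h334]))
    omega

/-- **The involution census for H(668).**  For a signed automorphism `(π, κ, d, e)` of a Hadamard matrix of order `668` with
`π² = κ² = 1` and `(π, κ) ≠ (1, 1)`: both `π ≠ 1` and `κ ≠ 1`, and with `f_r = #Fix π`, `f_c = #Fix κ` exactly one of —
(I) `f_r = f_c` even in `[2, 332]`, all fixed rows and columns of one sign; (II) `{f_r, f_c} = {0, 4}` with the four fixed signs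
summing to `0`; (III) `f_r = f_c = 0`. -/
theorem hadamard668_involution_census (hH : IsHadamardMatrix H) (hι : Fintype.card ι = 668)
    (π κ : Equiv.Perm ι) (d e : ι → ℤ) (haut : IsSignedAut H π κ d e)
    (hπ : π ^ 2 = 1) (hκ : κ ^ 2 = 1) (hne : π ≠ 1 ∨ κ ≠ 1) :
    π ≠ 1 ∧ κ ≠ 1 ∧
    (((univ.filter fun i => π i = i).card = (univ.filter fun j => κ j = j).card ∧
        2 ∣ (univ.filter fun i => π i = i).card ∧ 2 ≤ (univ.filter fun i => π i = i).card ∧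
        (univ.filter fun i => π i = i).card ≤ 332 ∧
        ∃ δ : ℤ, (δ = 1 ∨ δ = -1) ∧ (∀ i, π i = i → d i = δ) ∧ (∀ j, κ j = j → e j = δ)) ∨
     ((univ.filter fun i => π i = i).card = 0 ∧ (univ.filter fun j => κ j = j).card = 4 ∧
        ∑ j ∈ univ.filter (fun j => κ j = j), e j = 0) ∨
     ((univ.filter fun i => π i = i).card = 4 ∧ (univ.filter fun j => κ j = j).card = 0 ∧
        ∑ i ∈ univ.filter (fun i => π i = i), d i = 0) ∨
     ((univ.filter fun i => π i = i).card = 0 ∧ (univ.filter fun j => κ j = j).card = 0)) := by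
  have hcard : (Fintype.card ι : ℤ) ≠ 0 := by rw [hι]; norm_num
  have hmod : Fintype.card ι % 8 = 4 := by rw [hι]
  have hne4 : Fintype.card ι ≠ 4 := by rw [hι]; norm_num
  have hπinv : ∀ i, π (π i) = i := fun i => by
    have := congrArg (fun σ : Equiv.Perm ι => σ i) hπ; simpa [pow_two] using this
  have hκinv : ∀ j, κ (κ j) = j := fun j => by
    have := congrArg (fun σ : Equiv.Perm ι => σ j) hκ; simpa [pow_two] using this
  have hπ1 : π ≠ 1 := by
    intro h1; rw [h1] at haut
    have := signedAut_snd_eq_one_of_fst_eq_one hH hmod hne4 haut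
    rcases hne with h | h
    · exact h h1
    · exact h this
  have hκ1 : κ ≠ 1 := by
    intro h1; rw [h1] at haut
    exact hπ1 (signedAut_fst_eq_one_of_snd_eq_one hH hmod hne4 haut)
  refine ⟨hπ1, hκ1, ?_⟩
  have hautT : IsSignedAut Hᵀ κ π e d := isSignedAut_transpose haut
  have hHT : IsHadamardMatrix Hᵀ := isHadamard_transpose hH hcard
  by_cases hr : ∃ i, π i = i
  · by_cases hc : ∃ j, κ j = j
    · left
      obtain ⟨h1, h2, h3, h4⟩ := involution668_typeI hH hι haut hπinv hκinv hr hc hπ1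
      obtain ⟨r₀, hr₀⟩ := hr
      have hpos : 0 < (univ.filter fun i => π i = i).card := Finset.card_pos.mpr ⟨r₀, by simp [hr₀]⟩
      obtain ⟨b, hb⟩ := h3
      exact ⟨h1, ⟨b, hb⟩, by omega, h4, h2⟩
    · right; right; left
      have hfc : ∀ j, κ j ≠ j := fun j hj => hc ⟨j, hj⟩
      obtain ⟨h1, h2⟩ := involution668_typeII hHT hι hautT hκinv hπinv hfc hr
      have h0 : (univ.filter fun j => κ j = j).card = 0 := by
        rw [Finset.card_eq_zero, Finset.filter_eq_empty_iff]; intro j _; exact hfc j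
      exact ⟨h1, h0, h2⟩
  · have hfr : ∀ i, π i ≠ i := fun i hi => hr ⟨i, hi⟩
    have h0 : (univ.filter fun i => π i = i).card = 0 := by
      rw [Finset.card_eq_zero, Finset.filter_eq_empty_iff]; intro i _; exact hfr i
    by_cases hc : ∃ j, κ j = j
    · right; left
      obtain ⟨h1, h2⟩ := involution668_typeII hH hι haut hπinv hκinv hfr hc
      exact ⟨h0, h1, h2⟩
    · right; right; right
      have hfc : ∀ j, κ j ≠ j := fun j hj => hc ⟨j, hj⟩
      have h0' : (univ.filter fun j => κ j = j).card = 0 := by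
        rw [Finset.card_eq_zero, Finset.filter_eq_empty_iff]; intro j _; exact hfc j
      exact ⟨h0, h0'⟩

/-- **Order form.**  The same conclusion for a signed automorphism whose permutation pair has order `2`. -/
theorem hadamard668_signedAut_orderOf_2 (hH : IsHadamardMatrix H) (hι : Fintype.card ι = 668)
    (π κ : Equiv.Perm ι) (d e : ι → ℤ) (haut : IsSignedAut H π κ d e)
    (hord : orderOf ((π, κ) : Equiv.Perm ι × Equiv.Perm ι) = 2) :
    π ≠ 1 ∧ κ ≠ 1 ∧
    (((univ.filter fun i => π i = i).card = (univ.filter fun j => κ j = j).card ∧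
        2 ∣ (univ.filter fun i => π i = i).card ∧ 2 ≤ (univ.filter fun i => π i = i).card ∧
        (univ.filter fun i => π i = i).card ≤ 332 ∧
        ∃ δ : ℤ, (δ = 1 ∨ δ = -1) ∧ (∀ i, π i = i → d i = δ) ∧ (∀ j, κ j = j → e j = δ)) ∨
     ((univ.filter fun i => π i = i).card = 0 ∧ (univ.filter fun j => κ j = j).card = 4 ∧
        ∑ j ∈ univ.filter (fun j => κ j = j), e j = 0) ∨
     ((univ.filter fun i => π i = i).card = 4 ∧ (univ.filter fun j => κ j = j).card = 0 ∧
        ∑ i ∈ univ.filter (fun i => π i = i), d i = 0) ∨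
     ((univ.filter fun i => π i = i).card = 0 ∧ (univ.filter fun j => κ j = j).card = 0)) := by
  obtain ⟨hπ, hκ, hne⟩ := pow_data_of_orderOf hord (a := 1) (by norm_num) (by norm_num)
  rw [pow_one, pow_one] at hne
  exact hadamard668_involution_census hH hι π κ d e haut hπ hκ hne

end Summit.Ventures.DiscreteObjects.Hadamard
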